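import Summits.AtomisticToContinuum.Crystallization.Theorems.FrustratedLawDichotomyDRowsBcc
import Summits.AtomisticToContinuum.Crystallization.Theorems.FrustratedLawDichotomyDRowsArith
import Summits.AtomisticToContinuum.Crystallization.Theorems.FrustratedLawDichotomyShellMinimum
import Summits.AtomisticToContinuum.Crystallization.Theorems.FrustratedLawDichotomyPeriodicEnergyCeilingKernel

/-!
# DROWS-SOUND for the bcc chunk: the K certificate `…DRowsBcc.drows_bcc` read over `ℝ` (pieces (s2) ∘ (s4) ∘ (s5))

decomp-a2c hand-2 g46 — structural share for `AperiodicFrustratedLawGap` (stmt-27623), class-D rows (critic r1757 (C)(b)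
«DROWS-SOUND»; (233) census-1 g53 `…DRowsBcc`; generic arithmetic (s4) = `…DRowsArith`; shell minimum (s2) = lens-5 `…ShellMinimum`;
(s5) = TREE `…PeriodicEnergyCeilingKernel.eStar_le`).

The SPECIALISATION of `…DRowsArith` to the bcc K file — every lemma a one-line instantiation on census's own definitions
(`unfold …; exact …`), no re-proof — and the REAL READING of the certificate:

* `phiLo_sound`, `phiHi_sound`, `phiMinLo_sound`, `envHi_sound` — the four enclosures;
* `foldZ_le` + `shellSum_H0_eq` — the histogram fold is a lower reading of the real window sum `Σ_(D,m) inside  m·φ(s²D/3)` at EVERY scale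
  `s` of the leaf (symbolic fold with census's step; agreement with census's `shellSum` on `H0` by closed kernel evaluation);
* `leafOK_H0_sound` — `leafOK H0 eup i = true ⇒ 27/1000 ≤ ½·(window sum at s) − (1/12)·Env₆(s_i, R_i) − eup/S`;
* `eStar_le_EUPc` — (s5): `e⋆ ≤ EUPc/S` (`EUPc/2⁶⁰ = −0.71719… ≥ −0.7175 ≥ e⋆`, tree `eStar_le`);
* ★ `drows_bcc_sound` — for every leaf `i < 128` and every `s ∈ [sNum i/sDen, sNum (i+1)/sDen]`:
  `e⋆ + 27/1000 ≤ ½·Σ_{(D,m) ∈ H0, inside_i D} m·φ(s²·D/3) − (1/12)·Env₆(sNum i/sDen, 10·sNum i/sNum (i+1))`.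

What is NOT here (the remaining DROWS-SOUND pieces, owed): (s1) «`H0` = the true shell multiplicities of the bcc template about its root
within the cut» and the analytic assembly «½·(window sum − Env₆/6·…) ≤ rootEnergy V_LJ (count⌊s·Λ_bcc)» (window/tail split of the
root energy of a separated configuration, tail by TREE `…FarFieldSharp.sum_inv_pow_le_of_separated_sharp` at `δ = s_i`).  DEF-FREE.
-/

namespace Summit.AtomisticToContinuum.Crystallization.Theorems.FrustratedLawDichotomyDRowsBccSound

open Summit.AtomisticToContinuum.Crystallization.Theorems.FrustratedLawDichotomyDRowsBcc
open Summit.AtomisticToContinuum.Crystallization.Theorems.FrustratedLawDichotomyDRowsArith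
open Summit.AtomisticToContinuum.Crystallization.Theorems.FrustratedLawDichotomyCoherentFloorAlgebra (phiT)
open Summit.AtomisticToContinuum.Crystallization.Theorems.FrustratedLawDichotomyShellMinimum
  (phiT_le_phiT_of_le_one phiT_le_phiT_of_one_le)
open Summit.AtomisticToContinuum.Crystallization.Theorems.ChargedEnergyGapNegative (eStar)

/-! ## §1 The constants -/

/-- the scale `S = 2⁶⁰` is positive (private: the same numeral fact exists for other `2⁶⁰`-scaled certificates in the tree). -/
private theorem S_pos : 0 < S := by unfold S; decide

/-- `S` as a real numeral. -/
private theorem S_cast : ((S : ℤ) : ℝ) = 1152921504606846976 := by unfold S; norm_num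

/-- the common denominator of the scale is positive. -/
theorem sDen_pos : 0 < sDen := by unfold sDen XD; decide

/-- the leaf end points are positive. -/
theorem sNum_pos (i : ℕ) : 0 < sNum i := by unfold sNum xnum; omega

/-- the leaf windows are nondegenerate: `sNum i < sNum (i+1)`. -/
theorem sNum_lt_succ (i : ℕ) : sNum i < sNum (i + 1) := by unfold sNum xnum; push_cast; omega

/-! ## §2 The four enclosures, instantiated on census's definitions -/

/-- (s4) `phiLo p q ≤ S·φ(p/q)`. -/
theorem phiLo_sound {p q : ℤ} (hp : 0 < p) (hq : 0 < q) : ((phiLo p q : ℤ) : ℝ) ≤ S * phiT ((p : ℝ) / q) := by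
  unfold phiLo fdiv cdiv; exact phiLo_le S p q S_pos hp hq

/-- (s4) `S·φ(p/q) ≤ phiHi p q`. -/
theorem phiHi_sound {p q : ℤ} (hp : 0 < p) (hq : 0 < q) : S * phiT ((p : ℝ) / q) ≤ ((phiHi p q : ℤ) : ℝ) := by
  unfold phiHi fdiv cdiv; exact le_phiHi S p q S_pos hp hq

/-- (s2) ∘ (s4) `phiMinLo plo phi q ≤ S·φ(t)` for every `t` of the shell window `[plo/q, phi/q]` (`0 < plo`). -/
theorem phiMinLo_sound {plo phi q : ℤ} (hq : 0 < q) (hplo : 0 < plo) {t : ℝ} (h1 : (plo : ℝ) / q ≤ t) (h2 : t ≤ (phi : ℝ) / q) :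
    ((phiMinLo plo phi q : ℤ) : ℝ) ≤ S * phiT t := by
  unfold phiMinLo cdiv
  exact minLo_le hq hplo (fun p hp => phiLo_sound hp hq) (fun s t hs hst ht1 => phiT_le_phiT_of_le_one hs hst ht1)
    (fun s t h1 hst => phiT_le_phiT_of_one_le h1 hst) (fun t _ => neg_cdiv_twelve_le S S_pos.le t) S_pos.le h1 h2

/-- (s3) ∘ (s4) `S·(1/12)·Env₆(δ_i, R_i) ≤ envHi i` with `δ_i = sNum i/sDen`, `R_i = 10·sNum i/sNum (i+1)`. -/
theorem envHi_sound (i : ℕ) {δ R : ℝ} (hδ : δ = (sNum i : ℝ) / sDen) (hR : R = 10 * (sNum i : ℝ) / sNum (i + 1)) :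
    S * (1 / 12 * ((2 / δ) ^ 3 * R⁻¹ ^ 3 + 15 / 2 * (2 / δ) ^ 2 * R⁻¹ ^ 4 + 3 / 5 * (2 / δ) * R⁻¹ ^ 5 + 2 * R⁻¹ ^ 6)) ≤
      ((envHi i : ℤ) : ℝ) := by
  unfold envHi cdiv
  exact le_envHi S sDen (sNum i) (sNum (i + 1)) S_pos sDen_pos (sNum_pos i) (sNum_pos (i + 1)) hδ hR

/-! ## §3 The histogram fold at a real scale `s` of the leaf

Census's `shellSum` is a structural recursion whose defining equations the kernel cannot re-check symbolically against terms
elaborated outside the K file (its `inside` test compares against the 21-digit literal `100·3·sDen²`; a symbolic kernel `whnf` of that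
comparison unrolls `Nat.sub` on the literal).  We therefore read it in two steps: (i) a `List.foldl` with the SAME step, written here,
is a lower reading of the real window sum at every scale of the leaf (symbolic, by induction); (ii) on the certified histogram `H0` the
two folds AGREE on every leaf `i < 128` — a closed evaluation, `decide +kernel` (both sides are the same integer program). -/

/-- ★ (i) the fold with census's step — `acc ↦ acc + m·phiMinLo(slo²D, shi²D, 3·sDen²)` on the shells inside the cut `shi²·D < 100·3·sDen²` —
is a lower reading of `acc/S + Σ_{(D,m) inside} m·φ(s²D/3)` at EVERY `s ∈ [sNum i/sDen, sNum (i+1)/sDen]` (all shells `D ≥ 1`). -/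
theorem foldZ_le (i : ℕ) {s : ℝ} (hs1 : (sNum i : ℝ) / sDen ≤ s) (hs2 : s ≤ (sNum (i + 1) : ℝ) / sDen) :
    ∀ (h : List (ℕ × ℕ)), (∀ Dm ∈ h, 0 < Dm.1) → ∀ acc : ℤ,
      ((h.foldl (fun (acc : ℤ) (Dm : ℕ × ℕ) =>
          if sNum (i + 1) * sNum (i + 1) * (Dm.1 : ℤ) < 100 * (3 * sDen * sDen) then
            acc + (Dm.2 : ℤ) * phiMinLo (sNum i * sNum i * (Dm.1 : ℤ)) (sNum (i + 1) * sNum (i + 1) * (Dm.1 : ℤ)) (3 * sDen * sDen)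
          else acc) acc : ℤ) : ℝ) ≤
        acc + S * (h.map fun Dm : ℕ × ℕ =>
          if sNum (i + 1) * sNum (i + 1) * (Dm.1 : ℤ) < 100 * (3 * sDen * sDen) then (Dm.2 : ℝ) * phiT (s ^ 2 * Dm.1 / 3) else 0).sum := by
  have hD : (0 : ℝ) < sDen := by exact_mod_cast sDen_pos
  have hlo : (0 : ℝ) < sNum i := by exact_mod_cast sNum_pos i
  have hs0 : 0 < s := lt_of_lt_of_le (by positivity) hs1
  have hq : (0 : ℤ) < 3 * sDen * sDen := mul_pos (mul_pos (by norm_num) sDen_pos) sDen_pos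
  -- per shell: census's booked value is a lower reading of φ(s² D / 3)
  have hg : ∀ D : ℕ, 0 < D →
      ((phiMinLo (sNum i * sNum i * (D : ℤ)) (sNum (i + 1) * sNum (i + 1) * (D : ℤ)) (3 * sDen * sDen) : ℤ) : ℝ) ≤
        S * phiT (s ^ 2 * D / 3) := by
    intro D hDpos
    have hD' : (0 : ℝ) < D := by exact_mod_cast hDpos
    have hplo : (0 : ℤ) < sNum i * sNum i * (D : ℤ) := mul_pos (mul_pos (sNum_pos i) (sNum_pos i)) (by exact_mod_cast hDpos)
    refine phiMinLo_sound hq hplo ?_ ?_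
    · have e : (((sNum i * sNum i * (D : ℤ) : ℤ) : ℝ)) / ((3 * sDen * sDen : ℤ) : ℝ) = ((sNum i : ℝ) / sDen) ^ 2 * D / 3 := by
        push_cast; field_simp
      rw [e]
      have h1 : ((sNum i : ℝ) / sDen) ^ 2 ≤ s ^ 2 := pow_le_pow_left₀ (by positivity) hs1 2
      have h2 := mul_le_mul_of_nonneg_right h1 hD'.le
      linarith [div_le_div_of_nonneg_right h2 (by norm_num : (0 : ℝ) ≤ 3)]
    · have e : (((sNum (i + 1) * sNum (i + 1) * (D : ℤ) : ℤ) : ℝ)) / ((3 * sDen * sDen : ℤ) : ℝ) =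
          ((sNum (i + 1) : ℝ) / sDen) ^ 2 * D / 3 := by
        push_cast; field_simp
      rw [e]
      have h1 : s ^ 2 ≤ ((sNum (i + 1) : ℝ) / sDen) ^ 2 := pow_le_pow_left₀ hs0.le hs2 2
      have h2 := mul_le_mul_of_nonneg_right h1 hD'.le
      linarith [div_le_div_of_nonneg_right h2 (by norm_num : (0 : ℝ) ≤ 3)]
  intro h
  induction h with
  | nil => intro _ acc; simp
  | cons Dm rest ih =>
    intro hpos acc
    obtain ⟨D, m⟩ := Dm
    have hrest : ∀ Dm ∈ rest, 0 < Dm.1 := fun Dm hDm => hpos Dm (List.mem_cons_of_mem _ hDm)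
    have hDpos : 0 < D := hpos (D, m) List.mem_cons_self
    rw [List.foldl_cons, List.map_cons, List.sum_cons]
    refine (ih hrest _).trans ?_
    by_cases hP : sNum (i + 1) * sNum (i + 1) * (D : ℤ) < 100 * (3 * sDen * sDen)
    · simp only [hP, ↓reduceIte]
      have := hg D hDpos
      have hm : (0 : ℝ) ≤ m := by exact_mod_cast Nat.zero_le m
      push_cast
      nlinarith
    · simp only [hP, ↓reduceIte]
      simp

/-- every shell of the certified bcc histogram has `D ≥ 1` (the root is excluded). -/
theorem H0_pos : ∀ Dm ∈ H0, 0 < Dm.1 := by decide +kernel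

/-- ★ (ii) on the certified histogram `H0`, census's `shellSum i H0 0` IS the fold of (i), on every leaf `i < 128` (closed evaluation in the
kernel: the same integer program twice). -/
theorem shellSum_H0_eq : ∀ i ∈ List.range 128, shellSum i H0 0 =
    H0.foldl (fun (acc : ℤ) (Dm : ℕ × ℕ) =>
      if sNum (i + 1) * sNum (i + 1) * (Dm.1 : ℤ) < 100 * (3 * sDen * sDen) then
        acc + (Dm.2 : ℤ) * phiMinLo (sNum i * sNum i * (Dm.1 : ℤ)) (sNum (i + 1) * sNum (i + 1) * (Dm.1 : ℤ)) (3 * sDen * sDen)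
      else acc) 0 := by
  decide +kernel

/-! ## §4 The leaf inequality and (s5) -/

/-- ★ `leafOK H0 eup i = true ⇒ 27/1000 ≤ ½·(window sum at s) − (1/12)·Env₆(δ_i, R_i) − eup/S` for every leaf `i < 128` and every `s` of the leaf. -/
theorem leafOK_H0_sound {i : ℕ} (hi : i < 128) {s : ℝ} (hs1 : (sNum i : ℝ) / sDen ≤ s) (hs2 : s ≤ (sNum (i + 1) : ℝ) / sDen)
    {eup : ℤ} (hok : leafOK H0 eup i = true)
    {δ R : ℝ} (hδ : δ = (sNum i : ℝ) / sDen) (hR : R = 10 * (sNum i : ℝ) / sNum (i + 1)) :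
    27 / 1000 ≤ (H0.map fun Dm : ℕ × ℕ =>
        if sNum (i + 1) * sNum (i + 1) * (Dm.1 : ℤ) < 100 * (3 * sDen * sDen) then (Dm.2 : ℝ) * phiT (s ^ 2 * Dm.1 / 3) else 0).sum / 2
      - 1 / 12 * ((2 / δ) ^ 3 * R⁻¹ ^ 3 + 15 / 2 * (2 / δ) ^ 2 * R⁻¹ ^ 4 + 3 / 5 * (2 / δ) * R⁻¹ ^ 5 + 2 * R⁻¹ ^ 6)
      - (eup : ℝ) / S := by
  have hsh := foldZ_le i hs1 hs2 H0 H0_pos 0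
  rw [← shellSum_H0_eq i (List.mem_range.mpr hi)] at hsh
  simp only [Int.cast_zero, zero_add] at hsh
  have henv := envHi_sound i hδ hR
  unfold leafOK sigmaLo BAR fdiv cdiv at hok
  simp only [decide_eq_true_eq] at hok
  exact leaf_sound S_pos hsh henv hok

/-- (s5) the E_UP numeral dominates the periodic infimum: `e⋆ ≤ EUPc/S` (`EUPc/2⁶⁰ = −0.717191…`, tree `eStar_le : e⋆ ≤ −0.7175`). -/
theorem eStar_le_EUPc : eStar ≤ ((EUPc : ℤ) : ℝ) / S := by
  refine FrustratedLawDichotomyPeriodicEnergyCeilingKernel.eStar_le.trans ?_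
  rw [S_cast]; unfold EUPc; norm_num

/-- all 128 leaves of the certificate pass (census's `leavesW_0`, unpacked leaf by leaf). -/
theorem leafOK_H0_of_lt {i : ℕ} (hi : i < 128) : leafOK H0 EUPc i = true := by
  have hall : ∀ k ∈ List.range (128 - 0), leafOK H0 EUPc (0 + k) = true := List.all_eq_true.mp leavesW_0
  have hk := hall i (List.mem_range.mpr (by omega))
  rwa [zero_add] at hk

/-- ★★ **DROWS-SOUND, bcc chunk, modulo (s1) and the window/tail assembly.**  For every leaf `i < 128` of the scale window
`s/s⋆ ∈ [0.94, 1.06]` and every scale `s ∈ [sNum i/sDen, sNum (i+1)/sDen]`: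
`e⋆ + 27/1000 ≤ ½·Σ_{(D,m) ∈ H0, inside_i D} m·φ(s²D/3) − (1/12)·Env₆(sNum i/sDen, 10·sNum i/sNum (i+1))` — the kernel certificate
`drows_bcc` read over `ℝ` through the outward-rounding soundness of every primitive. -/
theorem drows_bcc_sound {i : ℕ} (hi : i < 128) {s : ℝ} (hs1 : (sNum i : ℝ) / sDen ≤ s) (hs2 : s ≤ (sNum (i + 1) : ℝ) / sDen)
    {δ R : ℝ} (hδ : δ = (sNum i : ℝ) / sDen) (hR : R = 10 * (sNum i : ℝ) / sNum (i + 1)) :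
    eStar + 27 / 1000 ≤ (H0.map fun Dm : ℕ × ℕ =>
        if sNum (i + 1) * sNum (i + 1) * (Dm.1 : ℤ) < 100 * (3 * sDen * sDen) then (Dm.2 : ℝ) * phiT (s ^ 2 * Dm.1 / 3) else 0).sum / 2
      - 1 / 12 * ((2 / δ) ^ 3 * R⁻¹ ^ 3 + 15 / 2 * (2 / δ) ^ 2 * R⁻¹ ^ 4 + 3 / 5 * (2 / δ) * R⁻¹ ^ 5 + 2 * R⁻¹ ^ 6) := by
  have h := leafOK_H0_sound hi hs1 hs2 (leafOK_H0_of_lt hi) hδ hR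
  have h5 := eStar_le_EUPc
  linarith

end Summit.AtomisticToContinuum.Crystallization.Theorems.FrustratedLawDichotomyDRowsBccSound
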